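import Summits.KontsevichZagierPeriods.KontsevichZagierPeriods.Theses.WeightLine
import Summits.KontsevichZagierPeriods.KontsevichZagierPeriods.Theorems.InverseLandauTateLiftingBetaGammaTruncated

/-!
# `BetaGammaTruncated` (stmt-KontsevichZagierPeriods-7183, route WeightLine) — proof

The route item `BetaGammaTruncated` (calibration #9 of route WeightLine): for every rational level `t`,
any Kontsevich–Zagier representation `[{x > 0, y > 0, x + y < t}, x^{-2/3} y^{-2/3}]` is equivalent to
any representation `[{0 < s < t} × (0,1), s^{-1/3} (u(1-u))^{-2/3}]` (one change of variables along the
Dirichlet polar chart `(s,u) ↦ (su, s(1-u))`). It is, verbatim,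
`InverseLandau.tateLifting_betaGammaTruncated` (stub `betaGammaTruncated` of the line `Sketch` of the
crux `TateLifting`, stmt-KontsevichZagierPeriods-9129, lead c10).
-/

namespace Summit.KontsevichZagierPeriods.WeightLine

/-- **`BetaGammaTruncated`** (route WeightLine, stmt-KontsevichZagierPeriods-7183): for every rational
`t`, `[{x > 0, y > 0, x + y < t}, x^{-2/3} y^{-2/3}] ∼ [{0 < s < t} × (0,1), s^{-1/3} (u(1-u))^{-2/3}]`
in the Kontsevich–Zagier calculus. Proof: `InverseLandau.tateLifting_betaGammaTruncated`.
[cite: KontsevichZagier2001, §1.2] -/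
theorem betaGammaTruncated_proof :
    Summit.KontsevichZagierPeriods.KontsevichZagierPeriods.Theses.WeightLine.BetaGammaTruncated :=
  Summit.KontsevichZagierPeriods.InverseLandau.tateLifting_betaGammaTruncated

end Summit.KontsevichZagierPeriods.WeightLine
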